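import Summits.NavierStokesRegularity.NavierStokesRegularity.Theses.RellichScar
import Summits.NavierStokesRegularity.NavierStokesRegularity.Theorems.ScarRigidity.Negative.LogicAndLoadBearing
import Literature.Analysis.FluidPDE.TypeIAncientMild
import Literature.Analysis.FluidPDE.ParasiticSlabFlow
import Literature.Analysis.FluidPDE.NSGaldiDualityBounds
import Summits.NavierStokesRegularity.NavierStokesRegularity.Theorems.RellichScarScarRigidityCoulombField
import Summits.NavierStokesRegularity.NavierStokesRegularity.Theorems.RellichScarScarRigidityCoulombGreen
import Summits.NavierStokesRegularity.NavierStokesRegularity.Theorems.RellichScarScarRigidityCoulombPairing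
import Summits.NavierStokesRegularity.NavierStokesRegularity.Theorems.RellichScarScarRigidityLogConvexityODE
import Summits.NavierStokesRegularity.NavierStokesRegularity.Theorems.RellichScarScarRigidityLogConvexityPairing
import Summits.NavierStokesRegularity.NavierStokesRegularity.Theorems.RellichScarScarRigidityLogConvexityGreen
import Summits.NavierStokesRegularity.NavierStokesRegularity.Theorems.RellichScarScarRigidityLogConvexityDifference
import HarnessLib

/-!
# `ScarRigidity` — line `finite-energy-log-convexity`, stub `stub_coulombEnergyPackage`:
# preparation of one time slice: decay bookkeeping (crux stmt-NavierStokesRegularity-11717)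

Helper file 11 of S4-E (`stub_coulombEnergyPackage`): bookkeeping for a single slice `t < 0`. From the
apex bounds of the line at the length `a = √(-t)` for two `C²` fields `V₁, V₂` and `C¹` pressures `Q₁, Q₂`
(`‖Vⱼ‖ ≤ C/(‖x‖+a)`, `‖DVⱼ‖ ≤ Lⱼ/(‖x‖+a)²`, `‖D²Vⱼ‖, ‖∇Qⱼ‖ ≤ Lⱼ/(‖x‖+a)³`, `|Qⱼ - cⱼ| ≤ Lⱼ/(‖x‖+a)²`)
and the twin majorant `‖V₁ - V₂‖ ≤ K/(‖x‖+a)³`, `slice_decay` produces the bounds consumed by the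
potential theory (`ρ`-form) and by the Green/pairing files (`(1+‖x‖)⁻ᵏ`-form, with `m = (min 1 a)⁻¹`)
for `w = V₁ - V₂`, `Vⱼ`, `DV₁` and the pressure difference `(Q₁ - c₁) - (Q₂ - c₂)`, together with
`div w = 0`, `∇((Q₁ - c₁) - (Q₂ - c₂)) = ∇Q₁ - ∇Q₂`, `Δw = ΔV₁ - ΔV₂`; plus three small facts used by
the slice package (`‖L‖² ≤ Σᵢ‖L eᵢ‖²`, `(∀ l, 0 ≤ c - 2lb) ⇒ b = 0`, `∫‖w‖² = 0 ⇒ w = 0`).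
-/

noncomputable section

open Set Filter Function MeasureTheory Metric TopologicalSpace
open scoped Topology ENNReal NNReal RealInnerProductSpace
open Literature.Analysis.FluidPDE
open Summit.NavierStokesRegularity.NavierStokesRegularity.Theses.RellichScar
open Summit.NavierStokesRegularity.NavierStokesRegularity.Theorems.ScarRigidity.Negative

set_option linter.dupNamespace false

namespace Summit.NavierStokesRegularity.NavierStokesRegularity.Theorems.RellichScarScarRigidity

open Real
open scoped Laplacian

/-! ## Small algebraic and measure-theoretic facts -/

/-- `‖L‖² ≤ Σᵢ ‖L eᵢ‖²` in the standard basis of `ℝ³` (the tree's `opNorm_le_sqrt_sum_sq`). [folklore] -/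
theorem opNorm_sq_le_sum_sq_basisFun (L : (EuclideanSpace ℝ (Fin 3)) →L[ℝ] (EuclideanSpace ℝ (Fin 3))) :
    ‖L‖ ^ 2 ≤ ∑ i : Fin 3, ‖L (EuclideanSpace.basisFun (Fin 3) ℝ i)‖ ^ 2 := by
  have h := opNorm_le_sqrt_sum_sq (EuclideanSpace.basisFun (Fin 3) ℝ) L
  have h0 : 0 ≤ ∑ i : Fin 3, ‖L (EuclideanSpace.basisFun (Fin 3) ℝ i)‖ ^ 2 :=
    Finset.sum_nonneg fun i _ => sq_nonneg _
  calc ‖L‖ ^ 2 ≤ (Real.sqrt (∑ i : Fin 3, ‖L (EuclideanSpace.basisFun (Fin 3) ℝ i)‖ ^ 2)) ^ 2 :=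
        pow_le_pow_left₀ (norm_nonneg _) h 2
    _ = ∑ i : Fin 3, ‖L (EuclideanSpace.basisFun (Fin 3) ℝ i)‖ ^ 2 := Real.sq_sqrt h0

/-- If `0 ≤ c - 2lb` for every real `l` and `0 ≤ b`, then `b = 0`. [folklore] -/
theorem eq_zero_of_forall_sub_nonneg {b c : ℝ} (hb : 0 ≤ b) (h : ∀ l : ℝ, 0 ≤ c - 2 * l * b) : b = 0 := by
  by_contra hne
  have hbpos : 0 < b := lt_of_le_of_ne hb (Ne.symm hne)
  have h1 := h ((c + 1) / (2 * b))
  have : 2 * ((c + 1) / (2 * b)) * b = c + 1 := by field_simp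
  linarith

/-- A continuous field on `ℝ³` with `∫ ‖w‖² = 0` (and `‖w‖² ∈ L¹`) vanishes identically. [folklore] -/
theorem eq_zero_of_integral_norm_sq_eq_zero {w : (EuclideanSpace ℝ (Fin 3)) → (EuclideanSpace ℝ (Fin 3))}
    (hw : Continuous w) (hint : Integrable (fun x => ‖w x‖ ^ 2) volume) (h0 : ∫ x, ‖w x‖ ^ 2 = 0) :
    ∀ x, w x = 0 := by
  have hae : (fun x => ‖w x‖ ^ 2) =ᵐ[volume] 0 :=
    (integral_eq_zero_iff_of_nonneg (fun x => sq_nonneg _) hint).1 h0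
  have heq : (fun x => ‖w x‖ ^ 2) = 0 := ((hw.norm.pow 2).ae_eq_iff_eq volume continuous_const).1 hae
  intro x
  have hx := congr_fun heq x
  simp only [Pi.zero_apply, ne_eq, OfNat.ofNat_ne_zero, not_false_eq_true, pow_eq_zero_iff,
    norm_eq_zero] at hx
  exact hx

/-! ## Decay bookkeeping of a slice -/

/-- **Decay bookkeeping of one slice** (see the module docstring). [folklore] -/
theorem slice_decay
    {V₁ V₂ : (EuclideanSpace ℝ (Fin 3)) → (EuclideanSpace ℝ (Fin 3))}
    {Q₁ Q₂ : (EuclideanSpace ℝ (Fin 3)) → ℝ} {c₁ c₂ C L₁ L₂ K a : ℝ}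
    (hV₁ : ContDiff ℝ 2 V₁) (hV₂ : ContDiff ℝ 2 V₂) (hQ₁ : ContDiff ℝ 1 Q₁) (hQ₂ : ContDiff ℝ 1 Q₂)
    (hdiv₁ : VectorCalculus.IsDivFree V₁) (hdiv₂ : VectorCalculus.IsDivFree V₂) (hC : 0 ≤ C) (ha : 0 < a)
    (hVb₁ : ∀ x, ‖V₁ x‖ ≤ C / (‖x‖ + a)) (hVb₂ : ∀ x, ‖V₂ x‖ ≤ C / (‖x‖ + a))
    (hg₁ : ∀ x, ‖fderiv ℝ V₁ x‖ ≤ L₁ / (‖x‖ + a) ^ 2)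
    (hh₁ : ∀ x, ‖iteratedFDeriv ℝ 2 V₁ x‖ ≤ L₁ / (‖x‖ + a) ^ 3)
    (hq₁ : ∀ x, |Q₁ x - c₁| ≤ L₁ / (‖x‖ + a) ^ 2) (hgq₁ : ∀ x, ‖gradient Q₁ x‖ ≤ L₁ / (‖x‖ + a) ^ 3)
    (hg₂ : ∀ x, ‖fderiv ℝ V₂ x‖ ≤ L₂ / (‖x‖ + a) ^ 2)
    (hh₂ : ∀ x, ‖iteratedFDeriv ℝ 2 V₂ x‖ ≤ L₂ / (‖x‖ + a) ^ 3)
    (hq₂ : ∀ x, |Q₂ x - c₂| ≤ L₂ / (‖x‖ + a) ^ 2) (hgq₂ : ∀ x, ‖gradient Q₂ x‖ ≤ L₂ / (‖x‖ + a) ^ 3)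
    (hK : ∀ x, ‖V₁ x - V₂ x‖ ≤ K / (‖x‖ + a) ^ 3) :
    ∃ m : ℝ, 0 ≤ m ∧
      (∀ y, ‖V₁ y - V₂ y‖ ≤ |K| * ((‖y‖ + a) ^ 3)⁻¹) ∧
      (∀ y, ‖fderiv ℝ (fun x => V₁ x - V₂ x) y‖ ≤ (|L₁| + |L₂|) * ((‖y‖ + a) ^ 2)⁻¹) ∧
      (∀ y, ‖iteratedFDeriv ℝ 2 (fun x => V₁ x - V₂ x) y‖ ≤ (|L₁| + |L₂|) * ((‖y‖ + a) ^ 3)⁻¹) ∧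
      (∀ x, ‖V₁ x - V₂ x‖ ≤ |K| * m ^ 3 * (1 + ‖x‖) ^ (-(3 : ℝ))) ∧
      (∀ x, ‖fderiv ℝ (fun x => V₁ x - V₂ x) x‖ ≤ (|L₁| + |L₂|) * m ^ 2 * (1 + ‖x‖) ^ (-(2 : ℝ))) ∧
      (∀ (x) (i : Fin 3), ‖fderiv ℝ (fun y => fderiv ℝ (fun x => V₁ x - V₂ x) y
          (EuclideanSpace.basisFun (Fin 3) ℝ i)) x (EuclideanSpace.basisFun (Fin 3) ℝ i)‖ ≤
        (|L₁| + |L₂|) * m ^ 3 * (1 + ‖x‖) ^ (-(3 : ℝ))) ∧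
      (∀ x, ‖V₁ x‖ ≤ C * m * (1 + ‖x‖) ^ (-(1 : ℝ))) ∧
      (∀ x, ‖V₂ x‖ ≤ C * m * (1 + ‖x‖) ^ (-(1 : ℝ))) ∧
      (∀ x, ‖fderiv ℝ V₁ x‖ ≤ |L₁| * m ^ 2 * (1 + ‖x‖) ^ (-(2 : ℝ))) ∧
      (∀ x, |(Q₁ x - c₁) - (Q₂ x - c₂)| ≤ (|L₁| + |L₂|) * m ^ 2 * (1 + ‖x‖) ^ (-(2 : ℝ))) ∧
      (∀ x, ‖gradient (fun x => (Q₁ x - c₁) - (Q₂ x - c₂)) x‖ ≤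
        (|L₁| + |L₂|) * m ^ 3 * (1 + ‖x‖) ^ (-(3 : ℝ))) ∧
      (∀ x, ‖V₁ x‖ ≤ C / a) ∧ (∀ x, ‖V₂ x‖ ≤ C / a) ∧
      VectorCalculus.IsDivFree (fun x => V₁ x - V₂ x) ∧
      (∀ x, gradient (fun x => (Q₁ x - c₁) - (Q₂ x - c₂)) x = gradient Q₁ x - gradient Q₂ x) ∧
      (∀ x, (Δ fun x => V₁ x - V₂ x) x = (Δ V₁) x - (Δ V₂) x) := by
  set w : (EuclideanSpace ℝ (Fin 3)) → (EuclideanSpace ℝ (Fin 3)) := fun x => V₁ x - V₂ x with hw_def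
  set e := EuclideanSpace.basisFun (Fin 3) ℝ with he_def
  set pr : (EuclideanSpace ℝ (Fin 3)) → ℝ := fun x => (Q₁ x - c₁) - (Q₂ x - c₂) with hpr_def
  have he1 : ∀ i, ‖e i‖ = 1 := fun i => e.norm_eq_one i
  have hwC2 : ContDiff ℝ 2 w := hV₁.sub hV₂
  have hV₁1 : ContDiff ℝ 1 V₁ := hV₁.of_le one_le_two
  have hV₂1 : ContDiff ℝ 1 V₂ := hV₂.of_le one_le_two
  have hd₁ : ∀ x, DifferentiableAt ℝ V₁ x := fun x => (hV₁1.differentiable one_ne_zero) x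
  have hd₂ : ∀ x, DifferentiableAt ℝ V₂ x := fun x => (hV₂1.differentiable one_ne_zero) x
  have hfw : ∀ x, fderiv ℝ w x = fderiv ℝ V₁ x - fderiv ℝ V₂ x := fun x => fderiv_fun_sub (hd₁ x) (hd₂ x)
  have hdivw : VectorCalculus.IsDivFree w := by
    intro x
    have h1 := hdiv₁ x
    have h2 := hdiv₂ x
    simp only [VectorCalculus.divergence] at h1 h2 ⊢
    rw [hfw x]
    simp [map_sub, h1, h2]
  have hgradpr : ∀ x, gradient pr x = gradient Q₁ x - gradient Q₂ x := by
    intro x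
    have hdq₁ : DifferentiableAt ℝ (fun x => Q₁ x - c₁) x := ((hQ₁.differentiable one_ne_zero) x).sub_const c₁
    have hdq₂ : DifferentiableAt ℝ (fun x => Q₂ x - c₂) x := ((hQ₂.differentiable one_ne_zero) x).sub_const c₂
    simp only [gradient, hpr_def]
    rw [fderiv_fun_sub hdq₁ hdq₂, fderiv_sub_const, fderiv_sub_const, map_sub]
  have hΔw : ∀ x, (Δ w) x = (Δ V₁) x - (Δ V₂) x := fun x =>
    (hV₁.contDiffAt).laplacian_sub (hV₂.contDiffAt)
  -- ### the decay constants
  set m : ℝ := (min 1 a)⁻¹ with hm_def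
  have hm0 : 0 ≤ m := inv_nonneg.2 (le_min zero_le_one ha.le)
  have hconv : ∀ (M : ℝ) (k : ℕ) (x : EuclideanSpace ℝ (Fin 3)), 0 ≤ M →
      M / (‖x‖ + a) ^ k ≤ M * m ^ k * (1 + ‖x‖) ^ (-(k : ℝ)) := fun M k x hM =>
    div_norm_add_pow_le_one_add_norm_rpow ha hM k x
  have habs : ∀ (M : ℝ) (k : ℕ) (x : EuclideanSpace ℝ (Fin 3)), M / (‖x‖ + a) ^ k ≤ |M| / (‖x‖ + a) ^ k :=
    fun M k x => div_le_div_of_nonneg_right (le_abs_self M) (by positivity)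
  have hL : 0 ≤ |L₁| + |L₂| := by positivity
  -- `ρ`-form bounds for the potential theory
  have hwbρ : ∀ y, ‖w y‖ ≤ |K| * ((‖y‖ + a) ^ 3)⁻¹ := fun y => by
    rw [← div_eq_mul_inv]; exact (hK y).trans (habs K 3 y)
  have hw1ρ : ∀ y, ‖fderiv ℝ w y‖ ≤ (|L₁| + |L₂|) * ((‖y‖ + a) ^ 2)⁻¹ := fun y => by
    rw [hfw y, ← div_eq_mul_inv, add_div]
    exact (norm_sub_le _ _).trans (add_le_add ((hg₁ y).trans (habs L₁ 2 y)) ((hg₂ y).trans (habs L₂ 2 y)))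
  have hw2ρ : ∀ y, ‖iteratedFDeriv ℝ 2 w y‖ ≤ (|L₁| + |L₂|) * ((‖y‖ + a) ^ 3)⁻¹ := fun y => by
    have h : iteratedFDeriv ℝ 2 w y = iteratedFDeriv ℝ 2 V₁ y - iteratedFDeriv ℝ 2 V₂ y :=
      iteratedFDeriv_sub_apply (f := V₁) (g := V₂) hV₁.contDiffAt hV₂.contDiffAt
    rw [h, ← div_eq_mul_inv, add_div]
    exact (norm_sub_le _ _).trans (add_le_add ((hh₁ y).trans (habs L₁ 3 y)) ((hh₂ y).trans (habs L₂ 3 y)))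
  -- `(1 + ‖x‖)`-form bounds for the Green and pairing files
  have hwb' : ∀ x, ‖w x‖ ≤ |K| * m ^ 3 * (1 + ‖x‖) ^ (-(3 : ℝ)) := fun x => by
    simpa using ((hK x).trans (habs K 3 x)).trans (hconv |K| 3 x (abs_nonneg K))
  have hw1' : ∀ x, ‖fderiv ℝ w x‖ ≤ (|L₁| + |L₂|) * m ^ 2 * (1 + ‖x‖) ^ (-(2 : ℝ)) := fun x => by
    have h : ‖fderiv ℝ w x‖ ≤ (|L₁| + |L₂|) / (‖x‖ + a) ^ 2 := by rw [div_eq_mul_inv]; exact hw1ρ x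
    simpa using h.trans (hconv _ 2 x hL)
  have hw2' : ∀ (x) (i : Fin 3), ‖fderiv ℝ (fun y => fderiv ℝ w y (e i)) x (e i)‖ ≤
      (|L₁| + |L₂|) * m ^ 3 * (1 + ‖x‖) ^ (-(3 : ℝ)) := fun x i => by
    have h : ‖fderiv ℝ (fun y => fderiv ℝ w y (e i)) x (e i)‖ ≤ (|L₁| + |L₂|) / (‖x‖ + a) ^ 3 := by
      rw [div_eq_mul_inv]; exact (norm_fderiv_fderiv_apply_le hwC2 x (e i) (he1 i)).trans (hw2ρ x)
    simpa using h.trans (hconv _ 3 x hL)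
  have hVb₁' : ∀ x, ‖V₁ x‖ ≤ C * m * (1 + ‖x‖) ^ (-(1 : ℝ)) := fun x => by
    have h : ‖V₁ x‖ ≤ C / (‖x‖ + a) ^ 1 := by rw [pow_one]; exact hVb₁ x
    simpa using h.trans (hconv C 1 x hC)
  have hVb₂' : ∀ x, ‖V₂ x‖ ≤ C * m * (1 + ‖x‖) ^ (-(1 : ℝ)) := fun x => by
    have h : ‖V₂ x‖ ≤ C / (‖x‖ + a) ^ 1 := by rw [pow_one]; exact hVb₂ x
    simpa using h.trans (hconv C 1 x hC)
  have hDV₁' : ∀ x, ‖fderiv ℝ V₁ x‖ ≤ |L₁| * m ^ 2 * (1 + ‖x‖) ^ (-(2 : ℝ)) := fun x => by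
    simpa using ((hg₁ x).trans (habs L₁ 2 x)).trans (hconv |L₁| 2 x (abs_nonneg _))
  have hprb : ∀ x, |pr x| ≤ (|L₁| + |L₂|) * m ^ 2 * (1 + ‖x‖) ^ (-(2 : ℝ)) := fun x => by
    have h : |pr x| ≤ (|L₁| + |L₂|) / (‖x‖ + a) ^ 2 := by
      rw [add_div]
      exact (abs_sub _ _).trans (add_le_add ((hq₁ x).trans (habs L₁ 2 x)) ((hq₂ x).trans (habs L₂ 2 x)))
    simpa using h.trans (hconv _ 2 x hL)
  have hgradprb : ∀ x, ‖gradient pr x‖ ≤ (|L₁| + |L₂|) * m ^ 3 * (1 + ‖x‖) ^ (-(3 : ℝ)) := fun x => by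
    have h : ‖gradient pr x‖ ≤ (|L₁| + |L₂|) / (‖x‖ + a) ^ 3 := by
      rw [hgradpr x, add_div]
      exact (norm_sub_le _ _).trans (add_le_add ((hgq₁ x).trans (habs L₁ 3 x)) ((hgq₂ x).trans (habs L₂ 3 x)))
    simpa using h.trans (hconv _ 3 x hL)
  have hM₁ : ∀ x, ‖V₁ x‖ ≤ C / a := fun x =>
    (hVb₁ x).trans (div_le_div_of_nonneg_left hC ha (le_add_of_nonneg_left (norm_nonneg _)))
  have hM₂ : ∀ x, ‖V₂ x‖ ≤ C / a := fun x =>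
    (hVb₂ x).trans (div_le_div_of_nonneg_left hC ha (le_add_of_nonneg_left (norm_nonneg _)))
  exact ⟨m, hm0, hwbρ, hw1ρ, hw2ρ, hwb', hw1', hw2', hVb₁', hVb₂', hDV₁', hprb, hgradprb, hM₁, hM₂, hdivw,
    hgradpr, hΔw⟩

/-! ## Registered sub-goal (helper stub of `stub_coulombEnergyPackage`) -/

/-- **Registered helper stub `stub_coulombSliceKernel`** (crux stmt-NavierStokesRegularity-11717,
line `finite-energy-log-convexity`, helper of S4-E): a continuous field with vanishing `L²` energy
vanishes, as registered (the last step `N₀ = 0 ⇒ b₀ = 0 ⇒ w = 0` of the slice package). [folklore] -/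
theorem stub_coulombSliceKernel :
    ∀ (w : EuclideanSpace ℝ (Fin 3) → EuclideanSpace ℝ (Fin 3)), Continuous w →
      Integrable (fun x => ‖w x‖ ^ 2) volume → ∫ x, ‖w x‖ ^ 2 = 0 → ∀ x, w x = 0 :=
  fun _w hw hint h0 => eq_zero_of_integral_norm_sq_eq_zero hw hint h0

end Summit.NavierStokesRegularity.NavierStokesRegularity.Theorems.RellichScarScarRigidity

end
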